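import Mathlib
import Literature.Analysis.SpecialFunctions.EllipticKLogBound
import HarnessLib

/-!
# The sharp logarithmic two-sided bound `log(4/k′) ≤ K(u) ≤ (1 + k′²/4)·log(4/k′)` near `u = 1`

Topic `Literature/Analysis/SpecialFunctions`. Sharpens `ellipticK_le_log`
(`Literature/Analysis/SpecialFunctions/EllipticKLogBound.lean`: `K(u) ≤ log(1/√(1-u)) + 2 log(1+√2)`, a
constant `2 log(1+√2) - log 4 ≈ 0.376` above the truth) and `log_le_ellipticK`
(`Literature/Probability/RandomPlanarGeometry/EllipticKBasic.lean`: `½ log((3-u)/(1-u)) ≤ K(u)`) to the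
optimal constant `log 4`: with the complementary modulus `k′ = √(1-u)` and `1/2 ≤ u < 1`,

* `log_four_div_le_ellipticK` — **`log(4/k′) ≤ K(u)`**;
* `ellipticK_le_log_four_div` — **`K(u) ≤ (1 + k′²/4)·log(4/k′)`**;
* `ellipticK_compl_log_two_sided` — the same pair in the form `K(1-b²)` vs `2 log 2 - log b`, `b² ≤ 1/2`;
* `ellipticK_sub_log_mem` — remainder form `0 ≤ K(m) - ½log(16/(1-m)) ≤ ¼(1-m)·½log(16/(1-m))`.

Method (elementary, series-free): the tree's representation
`K(1-b²) = ∫_{(0,∞)} dx/√((x²+1)(x²+b²))` (`integral_Ioi_agm_eq_ellipticK`) is split at the geometric mean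
`x = √b`; on `(0,√b]` one expands `(1+x²)^{-1/2}`, on `[√b,∞)` one expands `(1+b²/x²)^{-1/2}`, both by
`1 - t/2 ≤ (1+t)^{-1/2} ≤ 1 - t/2 + 3t²/8` (`inv_sqrt_one_add_bounds`); the four resulting integrands have
the explicit antiderivatives `Glo`, `Ghi` (in `arsinh(x/b)`, `x√(x²+b²)`) and `Hlo`, `Hhi` (in `arsinh x⁻¹`,
`√(x²+1)/x²`), and both pieces evaluate to `(1 + b²/4)·ℓ - b√(1+b)/4` plus `3/8`-corrections, where
`ℓ = arsinh(1/√b) = log(1+√(1+b)) - ½ log b`; the elementary bounds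
`log 2 + b/4 - 3b²/32 ≤ log(1+√(1+b)) ≤ log 2 + b/4 - 3b²/32 + 5b³/96` (`log_one_add_sqrt_lb/ub`) then
leave inequalities that close by linear certificates in the monomials of `b`. The asymptotic expansion
`K = log(4/k′) + ¼(log(4/k′) - 1)k′² + O(k′⁴ log k′)` [cite: BorweinBorwein1987, §1.3 (1.3.10)] shows both
constants are attained to leading order. Helper lemmas live in the sub-namespace `EllipticKLogSharp`.

Provenance: cell gate-hubbard-kl, planner seat hubbard-klscan-idea-4 g13 (item K2 `EllipticKLogRemainder` of
the crux-idea card «caustic-closed-form-row» on stmt-HubbardSuperconductivity-0158; turnkey file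
`EllipticKLogSharp.lean`, sha256[:16] 0de87a169c5ad637, 830 l.); used to make the cusp rows of the Kohn–Luttinger
hull certificate first-order in `1 - m`.  Filed by prover seat p4 g25 with these edits only: every helper of the
sub-namespace `EllipticKLogSharp` is `private` and carries a provenance-tagged docstring, the cited statements
carry `[cite: BorweinBorwein1987, §1.3 (1.3.10)]`, one `set_option maxHeartbeats 400000 in` on the assembly theorem;
statements and proofs otherwise byte-identical to the turnkey (one file: the helpers are private, so no split).

## References
* [BorweinBorwein1987] J. M. Borwein, P. B. Borwein, *Pi and the AGM*, Wiley (1987), §1.3, (1.3.10).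
-/

set_option linter.dupNamespace false

noncomputable section

open Real MeasureTheory Set Filter intervalIntegral
open scoped Topology
open Literature.Probability.RandomPlanarGeometry Literature.Analysis.SpecialFunctions

namespace Literature.Analysis.SpecialFunctions

namespace EllipticKLogSharp

/-! ### E. Two elementary bounds for `log (1 + √(1+b))` -/

/-- `d/db log(1 + √(1+b)) = 1/(2√(1+b)(1+√(1+b)))` for `b > -1`. [folklore] -/
private theorem hasDerivAt_log_one_add_sqrt {b : ℝ} (hb : -1 < b) :
    HasDerivAt (fun t : ℝ => Real.log (1 + Real.sqrt (1 + t)))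
      (1 / (2 * Real.sqrt (1 + b) * (1 + Real.sqrt (1 + b)))) b := by
  have h1 : HasDerivAt (fun t : ℝ => 1 + t) 1 b := by
    simpa using (hasDerivAt_id b).const_add (1:ℝ)
  have hpos : 0 < 1 + b := by linarith
  have h2 := h1.sqrt hpos.ne'
  have h3 : HasDerivAt (fun t : ℝ => 1 + Real.sqrt (1 + t)) (1 / (2 * Real.sqrt (1 + b))) b := by
    simpa using h2.const_add (1:ℝ)
  have hne : 1 + Real.sqrt (1 + b) ≠ 0 := by positivity
  have h4 := h3.log hne
  refine h4.congr_deriv ?_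
  rw [div_div]

/-- (E1) `log 2 + b/4 - 3b²/32 ≤ log(1 + √(1+b))` on `[0, 1]`. [folklore] -/
private theorem log_one_add_sqrt_lb {b : ℝ} (hb0 : 0 ≤ b) (hb1 : b ≤ 1) :
    Real.log 2 + b / 4 - 3 * b ^ 2 / 32 ≤ Real.log (1 + Real.sqrt (1 + b)) := by
  have hD : Convex ℝ (Icc (0:ℝ) 1) := convex_Icc _ _
  have hint : interior (Icc (0:ℝ) 1) = Ioo 0 1 := interior_Icc
  have hderiv : ∀ t : ℝ, -1 < t →
      HasDerivAt (fun t : ℝ => Real.log (1 + Real.sqrt (1 + t)) - t / 4 + 3 * t ^ 2 / 32)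
        (1 / (2 * Real.sqrt (1 + t) * (1 + Real.sqrt (1 + t))) - 1 / 4 + 3 * t / 16) t := by
    intro t ht
    have h1 := hasDerivAt_log_one_add_sqrt ht
    have h2 : HasDerivAt (fun t : ℝ => t / 4) (1 / 4) t := by
      simpa using (hasDerivAt_id t).div_const (4:ℝ)
    have h3 : HasDerivAt (fun t : ℝ => 3 * t ^ 2 / 32) (3 * t / 16) t := by
      have := ((hasDerivAt_pow 2 t).const_mul (3:ℝ)).div_const (32:ℝ)
      refine this.congr_deriv ?_
      simp; ring
    exact (h1.sub h2).add h3
  have hcont : ContinuousOn (fun t : ℝ => Real.log (1 + Real.sqrt (1 + t)) - t / 4 + 3 * t ^ 2 / 32)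
      (Icc (0:ℝ) 1) := fun t ht =>
    (hderiv t (by linarith [ht.1])).continuousAt.continuousWithinAt
  have hmono : MonotoneOn (fun t : ℝ => Real.log (1 + Real.sqrt (1 + t)) - t / 4 + 3 * t ^ 2 / 32)
      (Icc (0:ℝ) 1) := by
    refine monotoneOn_of_hasDerivWithinAt_nonneg hD hcont
      (f' := fun t => 1 / (2 * Real.sqrt (1 + t) * (1 + Real.sqrt (1 + t))) - 1 / 4 + 3 * t / 16) ?_ ?_
    · intro t ht
      rw [hint] at ht
      exact (hderiv t (by linarith [ht.1])).hasDerivWithinAt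
    · intro t ht
      rw [hint] at ht
      have h1t : 0 < 1 + t := by linarith [ht.1]
      set s := Real.sqrt (1 + t) with hs
      have hs1 : 1 ≤ s := Real.one_le_sqrt.mpr (by linarith [ht.1])
      have hs2 : s ^ 2 = 1 + t := Real.sq_sqrt h1t.le
      have ht' : t = s ^ 2 - 1 := by linarith
      have hpos : 0 < 2 * s * (1 + s) := by positivity
      have key : 1 - (1 / 4 - 3 * (s ^ 2 - 1) / 16) * (2 * s * (1 + s)) =
          (s - 1) ^ 2 * (3 * s ^ 2 + 9 * s + 8) / 8 := by ring
      have hnn : 0 ≤ (s - 1) ^ 2 * (3 * s ^ 2 + 9 * s + 8) / 8 := by positivity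
      have h : 1 / 4 - 3 * t / 16 ≤ 1 / (2 * s * (1 + s)) := by
        rw [le_div_iff₀ hpos, ht']
        linarith
      show 0 ≤ 1 / (2 * s * (1 + s)) - 1 / 4 + 3 * t / 16
      linarith
  have h := hmono (show (0:ℝ) ∈ Icc (0:ℝ) 1 from ⟨le_rfl, zero_le_one⟩) ⟨hb0, hb1⟩ hb0
  beta_reduce at h
  have h0 : Real.log (1 + Real.sqrt (1 + 0)) - 0 / 4 + 3 * (0:ℝ) ^ 2 / 32 = Real.log 2 := by
    norm_num
  rw [h0] at h
  linarith

/-- (E3) `log(1 + √(1+b)) ≤ log 2 + b/4 - 3b²/32 + 5b³/96` on `[0, 1]`. [folklore] -/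
private theorem log_one_add_sqrt_ub {b : ℝ} (hb0 : 0 ≤ b) (hb1 : b ≤ 1) :
    Real.log (1 + Real.sqrt (1 + b)) ≤ Real.log 2 + b / 4 - 3 * b ^ 2 / 32 + 5 * b ^ 3 / 96 := by
  have hD : Convex ℝ (Icc (0:ℝ) 1) := convex_Icc _ _
  have hint : interior (Icc (0:ℝ) 1) = Ioo 0 1 := interior_Icc
  have hderiv : ∀ t : ℝ, -1 < t →
      HasDerivAt (fun t : ℝ => t / 4 - 3 * t ^ 2 / 32 + 5 * t ^ 3 / 96 - Real.log (1 + Real.sqrt (1 + t)))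
        (1 / 4 - 3 * t / 16 + 5 * t ^ 2 / 32 - 1 / (2 * Real.sqrt (1 + t) * (1 + Real.sqrt (1 + t)))) t := by
    intro t ht
    have h1 := hasDerivAt_log_one_add_sqrt ht
    have h2 : HasDerivAt (fun t : ℝ => t / 4 - 3 * t ^ 2 / 32 + 5 * t ^ 3 / 96)
        (1 / 4 - 3 * t / 16 + 5 * t ^ 2 / 32) t := by
      have ha : HasDerivAt (fun t : ℝ => t / 4) (1 / 4) t := by
        simpa using (hasDerivAt_id t).div_const (4:ℝ)
      have hb : HasDerivAt (fun t : ℝ => 3 * t ^ 2 / 32) (3 * t / 16) t := by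
        have := ((hasDerivAt_pow 2 t).const_mul (3:ℝ)).div_const (32:ℝ)
        refine this.congr_deriv ?_
        simp; ring
      have hc : HasDerivAt (fun t : ℝ => 5 * t ^ 3 / 96) (5 * t ^ 2 / 32) t := by
        have := ((hasDerivAt_pow 3 t).const_mul (5:ℝ)).div_const (96:ℝ)
        refine this.congr_deriv ?_
        simp; ring
      exact (ha.sub hb).add hc
    exact h2.sub h1
  have hcont : ContinuousOn
      (fun t : ℝ => t / 4 - 3 * t ^ 2 / 32 + 5 * t ^ 3 / 96 - Real.log (1 + Real.sqrt (1 + t)))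
      (Icc (0:ℝ) 1) := fun t ht =>
    (hderiv t (by linarith [ht.1])).continuousAt.continuousWithinAt
  have hmono : MonotoneOn
      (fun t : ℝ => t / 4 - 3 * t ^ 2 / 32 + 5 * t ^ 3 / 96 - Real.log (1 + Real.sqrt (1 + t)))
      (Icc (0:ℝ) 1) := by
    refine monotoneOn_of_hasDerivWithinAt_nonneg hD hcont
      (f' := fun t => 1 / 4 - 3 * t / 16 + 5 * t ^ 2 / 32
        - 1 / (2 * Real.sqrt (1 + t) * (1 + Real.sqrt (1 + t)))) ?_ ?_
    · intro t ht
      rw [hint] at ht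
      exact (hderiv t (by linarith [ht.1])).hasDerivWithinAt
    · intro t ht
      rw [hint] at ht
      have h1t : 0 < 1 + t := by linarith [ht.1]
      set s := Real.sqrt (1 + t) with hs
      have hs1 : 1 ≤ s := Real.one_le_sqrt.mpr (by linarith [ht.1])
      have hs2 : s ^ 2 = 1 + t := Real.sq_sqrt h1t.le
      have ht' : t = s ^ 2 - 1 := by linarith
      have hpos : 0 < 2 * s * (1 + s) := by positivity
      have key : (1 / 4 - 3 * (s ^ 2 - 1) / 16 + 5 * (s ^ 2 - 1) ^ 2 / 32) * (2 * s * (1 + s)) - 1 =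
          (s - 1) ^ 3 * (5 * s ^ 3 + 20 * s ^ 2 + 29 * s + 16) / 16 := by ring
      have hnn : 0 ≤ (s - 1) ^ 3 * (5 * s ^ 3 + 20 * s ^ 2 + 29 * s + 16) / 16 := by
        have : 0 ≤ (s - 1) ^ 3 := pow_nonneg (by linarith) 3
        positivity
      have h : 1 / (2 * s * (1 + s)) ≤ 1 / 4 - 3 * t / 16 + 5 * t ^ 2 / 32 := by
        rw [div_le_iff₀ hpos, ht']
        linarith
      show 0 ≤ 1 / 4 - 3 * t / 16 + 5 * t ^ 2 / 32 - 1 / (2 * s * (1 + s))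
      linarith
  have h := hmono (show (0:ℝ) ∈ Icc (0:ℝ) 1 from ⟨le_rfl, zero_le_one⟩) ⟨hb0, hb1⟩ hb0
  beta_reduce at h
  have h0 : (0:ℝ) / 4 - 3 * (0:ℝ) ^ 2 / 32 + 5 * (0:ℝ) ^ 3 / 96 - Real.log (1 + Real.sqrt (1 + 0)) =
      - Real.log 2 := by
    norm_num
  rw [h0] at h
  linarith

/-! ### A. Binomial bounds for `(1+u)^{-1/2}` and the pointwise integrand bounds -/

/-- `1 - u/2 ≤ 1/√(1+u) ≤ 1 - u/2 + 3u²/8` for `0 ≤ u`. [folklore] -/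
private theorem inv_sqrt_one_add_bounds {u : ℝ} (hu0 : 0 ≤ u) :
    1 - u / 2 ≤ 1 / Real.sqrt (1 + u) ∧ 1 / Real.sqrt (1 + u) ≤ 1 - u / 2 + 3 * u ^ 2 / 8 := by
  have hpos : 0 < 1 + u := by linarith
  set r := Real.sqrt (1 + u) with hr
  have hr0 : 0 < r := Real.sqrt_pos.2 hpos
  have hr2 : r ^ 2 = 1 + u := Real.sq_sqrt hpos.le
  have hr1 : 1 ≤ r := Real.one_le_sqrt.mpr (by linarith)
  have hu : u = r ^ 2 - 1 := by linarith
  constructor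
  · rw [le_div_iff₀ hr0, hu]
    have key : 1 - (1 - (r ^ 2 - 1) / 2) * r = (r - 1) ^ 2 * (r + 2) / 2 := by ring
    have hnn : 0 ≤ (r - 1) ^ 2 * (r + 2) / 2 := by positivity
    linarith
  · rw [div_le_iff₀ hr0, hu]
    have key : (1 - (r ^ 2 - 1) / 2 + 3 * (r ^ 2 - 1) ^ 2 / 8) * r - 1 =
        (r - 1) ^ 3 * (3 * r ^ 2 + 9 * r + 8) / 8 := by ring
    have hnn : 0 ≤ (r - 1) ^ 3 * (3 * r ^ 2 + 9 * r + 8) / 8 := by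
      have : 0 ≤ (r - 1) ^ 3 := pow_nonneg (by linarith) 3
      positivity
    linarith

/-- The AGM integrand at `a = 1`. [folklore] -/
private def kint (b x : ℝ) : ℝ := 1 / Real.sqrt ((x ^ 2 + 1 ^ 2) * (x ^ 2 + b ^ 2))

/-- `kint b x = (1/√(x²+1))·(1/√(x²+b²))`. [folklore] -/
private theorem kint_eq (b x : ℝ) :
    kint b x = 1 / Real.sqrt (x ^ 2 + 1) * (1 / Real.sqrt (x ^ 2 + b ^ 2)) := by
  unfold kint
  rw [one_pow, Real.sqrt_mul (by positivity), one_div_mul_one_div]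

/-- Lower piece, pointwise: `(1 - x²/2)/√(x²+b²) ≤ kint ≤ (1 - x²/2 + 3x⁴/8)/√(x²+b²)`. [folklore] -/
private theorem kint_bounds_low {b x : ℝ} (hb : 0 < b) :
    (1 - x ^ 2 / 2) * (1 / Real.sqrt (x ^ 2 + b ^ 2)) ≤ kint b x ∧
      kint b x ≤ (1 - x ^ 2 / 2 + 3 * x ^ 4 / 8) * (1 / Real.sqrt (x ^ 2 + b ^ 2)) := by
  rw [kint_eq]
  have hw : 0 < 1 / Real.sqrt (x ^ 2 + b ^ 2) := by positivity
  obtain ⟨h1, h2⟩ := inv_sqrt_one_add_bounds (sq_nonneg x)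
  rw [add_comm (1:ℝ) (x ^ 2)] at h1 h2
  refine ⟨mul_le_mul_of_nonneg_right h1 hw.le, mul_le_mul_of_nonneg_right ?_ hw.le⟩
  calc 1 / Real.sqrt (x ^ 2 + 1) ≤ 1 - x ^ 2 / 2 + 3 * (x ^ 2) ^ 2 / 8 := h2
    _ = 1 - x ^ 2 / 2 + 3 * x ^ 4 / 8 := by ring

/-- Upper piece, pointwise (`x > 0`):
`(1 - b²/(2x²))/(x√(x²+1)) ≤ kint ≤ (1 - b²/(2x²) + 3b⁴/(8x⁴))/(x√(x²+1))`. [folklore] -/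
private theorem kint_bounds_high {b x : ℝ} (hb : 0 < b) (hx : 0 < x) :
    (1 - b ^ 2 / (2 * x ^ 2)) * (1 / (x * Real.sqrt (x ^ 2 + 1))) ≤ kint b x ∧
      kint b x ≤ (1 - b ^ 2 / (2 * x ^ 2) + 3 * b ^ 4 / (8 * x ^ 4)) * (1 / (x * Real.sqrt (x ^ 2 + 1))) := by
  rw [kint_eq]
  have hs1 : 0 < Real.sqrt (x ^ 2 + 1) := by positivity
  -- `1/√(x²+b²) = (1/x) · 1/√(1+u)`, `u = b²/x²`
  have hu0 : 0 ≤ b ^ 2 / x ^ 2 := by positivity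
  have hfac : Real.sqrt (x ^ 2 + b ^ 2) = x * Real.sqrt (1 + b ^ 2 / x ^ 2) := by
    rw [show x ^ 2 + b ^ 2 = x ^ 2 * (1 + b ^ 2 / x ^ 2) by field_simp,
      Real.sqrt_mul (by positivity), Real.sqrt_sq hx.le]
  obtain ⟨h1, h2⟩ := inv_sqrt_one_add_bounds hu0
  have hr0 : 0 < Real.sqrt (1 + b ^ 2 / x ^ 2) := by positivity
  have e1 : 1 / Real.sqrt (x ^ 2 + 1) * (1 / Real.sqrt (x ^ 2 + b ^ 2)) =
      (1 / Real.sqrt (1 + b ^ 2 / x ^ 2)) * (1 / (x * Real.sqrt (x ^ 2 + 1))) := by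
    rw [hfac]
    field_simp
  rw [e1]
  have hw : 0 < 1 / (x * Real.sqrt (x ^ 2 + 1)) := by positivity
  have e2 : b ^ 2 / x ^ 2 / 2 = b ^ 2 / (2 * x ^ 2) := by
    rw [div_div]
    ring_nf
  have e3 : 3 * (b ^ 2 / x ^ 2) ^ 2 / 8 = 3 * b ^ 4 / (8 * x ^ 4) := by
    field_simp
  rw [e2] at h1 h2
  rw [e3] at h2
  exact ⟨mul_le_mul_of_nonneg_right h1 hw.le, mul_le_mul_of_nonneg_right h2 hw.le⟩


/-! ### B. Antiderivatives on the two pieces -/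

/-- `d/dx arsinh(x/b) = 1/√(x²+b²)` (`b > 0`). [folklore] -/
private theorem hasDerivAt_arsinh_div {b : ℝ} (hb : 0 < b) (x : ℝ) :
    HasDerivAt (fun x : ℝ => Real.arsinh (x / b)) (1 / Real.sqrt (x ^ 2 + b ^ 2)) x := by
  have h := ((hasDerivAt_id' x).div_const b).arsinh
  convert h using 1
  rw [smul_eq_mul]
  have hb2 : Real.sqrt (x ^ 2 + b ^ 2) = b * Real.sqrt (1 + (x / b) ^ 2) := by
    rw [show x ^ 2 + b ^ 2 = b ^ 2 * (1 + (x / b) ^ 2) by field_simp; ring,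
      Real.sqrt_mul (by positivity), Real.sqrt_sq hb.le]
  rw [hb2]
  have := (Real.sqrt_pos.2 (by positivity : (0:ℝ) < 1 + (x / b) ^ 2)).ne'
  field_simp

/-- `d/dx √(x²+c) = x/√(x²+c)` (`c > 0`). [folklore] -/
private theorem hasDerivAt_sqrt_sq_add {c : ℝ} (hc : 0 < c) (x : ℝ) :
    HasDerivAt (fun x : ℝ => Real.sqrt (x ^ 2 + c)) (x / Real.sqrt (x ^ 2 + c)) x := by
  have h1 : HasDerivAt (fun x : ℝ => x ^ 2 + c) (2 * x) x := by
    simpa using (hasDerivAt_pow 2 x).add_const c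
  have hne : x ^ 2 + c ≠ 0 := by positivity
  refine (h1.sqrt hne).congr_deriv ?_
  exact mul_div_mul_left _ _ two_ne_zero

/-- `d/dx [x S] = (2x²+b²)/S`, `S = √(x²+b²)`. [folklore] -/
private theorem hasDerivAt_mul_sqrt {b : ℝ} (hb : 0 < b) (x : ℝ) :
    HasDerivAt (fun x : ℝ => x * Real.sqrt (x ^ 2 + b ^ 2))
      ((2 * x ^ 2 + b ^ 2) / Real.sqrt (x ^ 2 + b ^ 2)) x := by
  have hS := hasDerivAt_sqrt_sq_add (pow_pos hb 2) x
  have h := (hasDerivAt_id' x).mul hS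
  refine h.congr_deriv ?_
  set S := Real.sqrt (x ^ 2 + b ^ 2) with hSdef
  have hS0 : 0 < S := Real.sqrt_pos.2 (by positivity)
  have hS2 : S ^ 2 = x ^ 2 + b ^ 2 := Real.sq_sqrt (by positivity)
  have hSne : S ≠ 0 := hS0.ne'
  field_simp
  ring_nf
  simp only [hS2]
  ring_nf

/-- `d/dx [(x³/4 - 3b²x/8) S] = (x⁴ - 3b⁴/8)/S`. [folklore] -/
private theorem hasDerivAt_poly_mul_sqrt {b : ℝ} (hb : 0 < b) (x : ℝ) :
    HasDerivAt (fun x : ℝ => (x ^ 3 / 4 - 3 * b ^ 2 * x / 8) * Real.sqrt (x ^ 2 + b ^ 2))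
      ((x ^ 4 - 3 * b ^ 4 / 8) / Real.sqrt (x ^ 2 + b ^ 2)) x := by
  have hS := hasDerivAt_sqrt_sq_add (pow_pos hb 2) x
  have h3 : HasDerivAt (fun x : ℝ => x ^ 3) (3 * x ^ 2) x := by
    simpa using hasDerivAt_pow 3 x
  have hp : HasDerivAt (fun x : ℝ => x ^ 3 / 4 - 3 * b ^ 2 * x / 8)
      (3 * x ^ 2 / 4 - 3 * b ^ 2 * 1 / 8) x :=
    (h3.div_const 4).sub (((hasDerivAt_id' x).const_mul (3 * b ^ 2)).div_const 8)
  have h := hp.mul hS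
  refine h.congr_deriv ?_
  set S := Real.sqrt (x ^ 2 + b ^ 2) with hSdef
  have hS0 : 0 < S := Real.sqrt_pos.2 (by positivity)
  have hS2 : S ^ 2 = x ^ 2 + b ^ 2 := Real.sq_sqrt (by positivity)
  have hSne : S ≠ 0 := hS0.ne'
  field_simp
  ring_nf
  simp only [hS2]
  ring_nf

/-- Lower antiderivative on the lower piece. [folklore] -/
private def Glo (b x : ℝ) : ℝ := (1 + b ^ 2 / 4) * Real.arsinh (x / b) - x * Real.sqrt (x ^ 2 + b ^ 2) / 4

/-- Upper antiderivative on the lower piece. [folklore] -/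
private def Ghi (b x : ℝ) : ℝ :=
  Glo b x + 3 / 8 * ((x ^ 3 / 4 - 3 * b ^ 2 * x / 8) * Real.sqrt (x ^ 2 + b ^ 2)
    + 3 * b ^ 4 / 8 * Real.arsinh (x / b))

/-- The lower model integrand on the lower piece. [folklore] -/
private def glo (b x : ℝ) : ℝ := (1 - x ^ 2 / 2) * (1 / Real.sqrt (x ^ 2 + b ^ 2))

/-- The upper model integrand on the lower piece. [folklore] -/
private def ghi (b x : ℝ) : ℝ := (1 - x ^ 2 / 2 + 3 * x ^ 4 / 8) * (1 / Real.sqrt (x ^ 2 + b ^ 2))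

/-- `Glo b` is an antiderivative of the lower model integrand `glo b` (`b > 0`). [folklore] -/
private theorem hasDerivAt_Glo {b : ℝ} (hb : 0 < b) (x : ℝ) : HasDerivAt (Glo b) (glo b x) x := by
  show HasDerivAt (fun x : ℝ => (1 + b ^ 2 / 4) * Real.arsinh (x / b) - x * Real.sqrt (x ^ 2 + b ^ 2) / 4)
    ((1 - x ^ 2 / 2) * (1 / Real.sqrt (x ^ 2 + b ^ 2))) x
  have hA := hasDerivAt_arsinh_div hb x
  have hB := hasDerivAt_mul_sqrt hb x
  have h := (hA.const_mul (1 + b ^ 2 / 4)).sub (hB.div_const 4)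
  refine h.congr_deriv ?_
  have hS0 : 0 < Real.sqrt (x ^ 2 + b ^ 2) := Real.sqrt_pos.2 (by positivity)
  have hSne : Real.sqrt (x ^ 2 + b ^ 2) ≠ 0 := hS0.ne'
  field_simp
  ring

/-- `Ghi b` is an antiderivative of the upper model integrand `ghi b` (`b > 0`). [folklore] -/
private theorem hasDerivAt_Ghi {b : ℝ} (hb : 0 < b) (x : ℝ) : HasDerivAt (Ghi b) (ghi b x) x := by
  show HasDerivAt (fun x : ℝ => Glo b x + 3 / 8 * ((x ^ 3 / 4 - 3 * b ^ 2 * x / 8) * Real.sqrt (x ^ 2 + b ^ 2)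
      + 3 * b ^ 4 / 8 * Real.arsinh (x / b)))
    ((1 - x ^ 2 / 2 + 3 * x ^ 4 / 8) * (1 / Real.sqrt (x ^ 2 + b ^ 2))) x
  have h1 := hasDerivAt_Glo hb x
  have hA := hasDerivAt_arsinh_div hb x
  have hC := hasDerivAt_poly_mul_sqrt hb x
  have h2 := (hC.add (hA.const_mul (3 * b ^ 4 / 8))).const_mul (3 / 8 : ℝ)
  have h := h1.add h2
  refine h.congr_deriv ?_
  simp only [glo]
  have hS0 : 0 < Real.sqrt (x ^ 2 + b ^ 2) := Real.sqrt_pos.2 (by positivity)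
  have hSne : Real.sqrt (x ^ 2 + b ^ 2) ≠ 0 := hS0.ne'
  field_simp
  ring

/-- `d/dx [-arsinh(1/x)] = 1/(x √(x²+1))` (`x > 0`). [folklore] -/
private theorem hasDerivAt_neg_arsinh_inv {x : ℝ} (hx : 0 < x) :
    HasDerivAt (fun y : ℝ => -Real.arsinh y⁻¹) (1 / (x * Real.sqrt (x ^ 2 + 1))) x := by
  have h0 := (hasDerivAt_inv hx.ne').arsinh
  have h : HasDerivAt (fun y : ℝ => -Real.arsinh y⁻¹) (-((Real.sqrt (1 + x⁻¹ ^ 2))⁻¹ • -(x ^ 2)⁻¹)) x :=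
    h0.neg
  convert h using 1
  rw [smul_eq_mul]
  have hs : Real.sqrt (1 + (x⁻¹) ^ 2) = Real.sqrt (x ^ 2 + 1) / x := by
    rw [show 1 + (x⁻¹) ^ 2 = (x ^ 2 + 1) / x ^ 2 by field_simp, Real.sqrt_div' _ (by positivity),
      Real.sqrt_sq hx.le]
  rw [hs]
  have := (Real.sqrt_pos.2 (by positivity : (0:ℝ) < x ^ 2 + 1)).ne'
  field_simp

/-- `d/dx [T/x²] = -(x²+2)/(x³ T)`, `T = √(x²+1)`, `x > 0`. [folklore] -/
private theorem hasDerivAt_sqrt_div_sq {x : ℝ} (hx : 0 < x) :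
    HasDerivAt (fun y : ℝ => Real.sqrt (y ^ 2 + 1) / y ^ 2)
      (-(x ^ 2 + 2) / (x ^ 3 * Real.sqrt (x ^ 2 + 1))) x := by
  have hT := hasDerivAt_sqrt_sq_add one_pos x
  have hp : HasDerivAt (fun y : ℝ => y ^ 2) (2 * x) x := by simpa using hasDerivAt_pow 2 x
  have h := hT.div hp (by positivity : x ^ 2 ≠ 0)
  refine h.congr_deriv ?_
  set T := Real.sqrt (x ^ 2 + 1) with hTdef
  have hT0 : 0 < T := Real.sqrt_pos.2 (by positivity)
  have hT2 : T ^ 2 = x ^ 2 + 1 := Real.sq_sqrt (by positivity)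
  have hTne : T ≠ 0 := hT0.ne'
  have hx0 : x ≠ 0 := hx.ne'
  field_simp
  ring_nf
  simp only [hT2]
  ring_nf

/-- `d/dx [(T/x²)(3/8 - (1/4)(x²)⁻¹)] = (8 - 3x⁴)/(8 x⁵ T)`. [folklore] -/
private theorem hasDerivAt_B5prod {x : ℝ} (hx : 0 < x) :
    HasDerivAt (fun y : ℝ => Real.sqrt (y ^ 2 + 1) / y ^ 2 * (3 / 8 - 1 / 4 * (y ^ 2)⁻¹))
      ((8 - 3 * x ^ 4) / (8 * x ^ 5 * Real.sqrt (x ^ 2 + 1))) x := by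
  have hB := hasDerivAt_sqrt_div_sq hx
  have hp : HasDerivAt (fun y : ℝ => y ^ 2) (2 * x) x := by simpa using hasDerivAt_pow 2 x
  have hq : HasDerivAt (fun y : ℝ => 3 / 8 - 1 / 4 * (y ^ 2)⁻¹) (0 - 1 / 4 * (-(2 * x) / (x ^ 2) ^ 2)) x :=
    (hasDerivAt_const x (3 / 8 : ℝ)).sub ((hp.inv (by positivity)).const_mul (1 / 4 : ℝ))
  have h := hB.mul hq
  refine h.congr_deriv ?_
  set T := Real.sqrt (x ^ 2 + 1) with hTdef
  have hT0 : 0 < T := Real.sqrt_pos.2 (by positivity)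
  have hT2 : T ^ 2 = x ^ 2 + 1 := Real.sq_sqrt (by positivity)
  have hTne : T ≠ 0 := hT0.ne'
  have hx0 : x ≠ 0 := hx.ne'
  field_simp
  ring_nf
  simp only [hT2]
  ring_nf

/-- Lower antiderivative on the upper piece. [folklore] -/
private def Hlo (b x : ℝ) : ℝ :=
  (1 + b ^ 2 / 4) * -Real.arsinh x⁻¹ + b ^ 2 / 4 * (Real.sqrt (x ^ 2 + 1) / x ^ 2)

/-- Upper antiderivative on the upper piece. [folklore] -/
private def Hhi (b x : ℝ) : ℝ :=
  Hlo b x + 3 * b ^ 4 / 8 * (Real.sqrt (x ^ 2 + 1) / x ^ 2 * (3 / 8 - 1 / 4 * (x ^ 2)⁻¹)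
    + 3 / 8 * -Real.arsinh x⁻¹)

/-- The lower model integrand on the upper piece. [folklore] -/
private def hlo (b x : ℝ) : ℝ := (1 - b ^ 2 / (2 * x ^ 2)) * (1 / (x * Real.sqrt (x ^ 2 + 1)))

/-- The upper model integrand on the upper piece. [folklore] -/
private def hhi (b x : ℝ) : ℝ :=
  (1 - b ^ 2 / (2 * x ^ 2) + 3 * b ^ 4 / (8 * x ^ 4)) * (1 / (x * Real.sqrt (x ^ 2 + 1)))

/-- `Hlo b` is an antiderivative of `hlo b` on `(0, ∞)`. [folklore] -/
private theorem hasDerivAt_Hlo (b : ℝ) {x : ℝ} (hx : 0 < x) : HasDerivAt (Hlo b) (hlo b x) x := by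
  show HasDerivAt (fun y : ℝ => (1 + b ^ 2 / 4) * -Real.arsinh y⁻¹ + b ^ 2 / 4 * (Real.sqrt (y ^ 2 + 1) / y ^ 2))
    ((1 - b ^ 2 / (2 * x ^ 2)) * (1 / (x * Real.sqrt (x ^ 2 + 1)))) x
  have hA := hasDerivAt_neg_arsinh_inv hx
  have hB := hasDerivAt_sqrt_div_sq hx
  have h := (hA.const_mul (1 + b ^ 2 / 4)).add (hB.const_mul (b ^ 2 / 4))
  refine h.congr_deriv ?_
  have hT0 : 0 < Real.sqrt (x ^ 2 + 1) := Real.sqrt_pos.2 (by positivity)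
  have hTne : Real.sqrt (x ^ 2 + 1) ≠ 0 := hT0.ne'
  have hx0 : x ≠ 0 := hx.ne'
  field_simp
  ring

/-- `Hhi b` is an antiderivative of `hhi b` on `(0, ∞)`. [folklore] -/
private theorem hasDerivAt_Hhi (b : ℝ) {x : ℝ} (hx : 0 < x) : HasDerivAt (Hhi b) (hhi b x) x := by
  show HasDerivAt (fun y : ℝ => Hlo b y + 3 * b ^ 4 / 8 * (Real.sqrt (y ^ 2 + 1) / y ^ 2 * (3 / 8 - 1 / 4 * (y ^ 2)⁻¹)
      + 3 / 8 * -Real.arsinh y⁻¹))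
    ((1 - b ^ 2 / (2 * x ^ 2) + 3 * b ^ 4 / (8 * x ^ 4)) * (1 / (x * Real.sqrt (x ^ 2 + 1)))) x
  have h1 := hasDerivAt_Hlo b hx
  have hA := hasDerivAt_neg_arsinh_inv hx
  have hC := hasDerivAt_B5prod hx
  have h2 := (hC.add (hA.const_mul (3 / 8 : ℝ))).const_mul (3 * b ^ 4 / 8)
  have h := h1.add h2
  refine h.congr_deriv ?_
  simp only [hlo]
  have hT0 : 0 < Real.sqrt (x ^ 2 + 1) := Real.sqrt_pos.2 (by positivity)
  have hTne : Real.sqrt (x ^ 2 + 1) ≠ 0 := hT0.ne'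
  have hx0 : x ≠ 0 := hx.ne'
  field_simp
  ring


/-! ### C. The integrals of the model integrands on the two pieces -/

/-- The AGM integrand `kint b` is integrable on `ℝ` (`b > 0`). [folklore] -/
private theorem integrable_kint {b : ℝ} (hb : 0 < b) : Integrable (kint b) := by
  show Integrable (fun x : ℝ => 1 / Real.sqrt ((x ^ 2 + 1 ^ 2) * (x ^ 2 + b ^ 2)))
  exact integrable_gaussAGMIntegrand one_pos hb

/-- `K(1 − b²) = ∫_{(0,∞)} kint b` — the tree's AGM representation `integral_Ioi_agm_eq_ellipticK` at `a = 1`. [folklore] -/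
private theorem ellipticK_eq_integral_kint {b : ℝ} (hb : 0 < b) :
    ellipticK (1 - b ^ 2) = ∫ x in Ioi (0:ℝ), kint b x := by
  have h := integral_Ioi_agm_eq_ellipticK one_pos hb
  simp only [kint]
  rw [h]
  simp

/-- Splitting the half-line integral of `kint b` at `a ≥ 0`. [folklore] -/
private theorem integral_kint_split {b a : ℝ} (hb : 0 < b) (ha : 0 ≤ a) :
    ∫ x in Ioi (0:ℝ), kint b x = (∫ x in (0:ℝ)..a, kint b x) + ∫ x in Ioi a, kint b x := by
  have hint := integrable_kint hb
  rw [intervalIntegral.integral_of_le ha, ← Ioc_union_Ioi_eq_Ioi ha,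
    setIntegral_union (Ioc_disjoint_Ioi le_rfl) measurableSet_Ioi hint.integrableOn hint.integrableOn]

/-- `glo b` is continuous (`b > 0`). [folklore] -/
private theorem continuous_glo {b : ℝ} (hb : 0 < b) : Continuous (glo b) := by
  unfold glo
  have h1 : Continuous fun x : ℝ => Real.sqrt (x ^ 2 + b ^ 2) :=
    ((continuous_pow 2).add continuous_const).sqrt
  have h2 : ∀ x : ℝ, Real.sqrt (x ^ 2 + b ^ 2) ≠ 0 := fun x => (Real.sqrt_pos.2 (by positivity)).ne'
  exact (continuous_const.sub ((continuous_pow 2).div_const 2)).mul (continuous_const.div h1 h2)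

/-- `ghi b` is continuous (`b > 0`). [folklore] -/
private theorem continuous_ghi {b : ℝ} (hb : 0 < b) : Continuous (ghi b) := by
  unfold ghi
  have h1 : Continuous fun x : ℝ => Real.sqrt (x ^ 2 + b ^ 2) :=
    ((continuous_pow 2).add continuous_const).sqrt
  have h2 : ∀ x : ℝ, Real.sqrt (x ^ 2 + b ^ 2) ≠ 0 := fun x => (Real.sqrt_pos.2 (by positivity)).ne'
  exact ((continuous_const.sub ((continuous_pow 2).div_const 2)).add
    (((continuous_pow 4).const_mul 3).div_const 8)).mul (continuous_const.div h1 h2)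

/-- LOWER PIECE: `Glo(a) - Glo(0) ≤ ∫₀^a kint ≤ Ghi(a) - Ghi(0)`. [folklore] -/
private theorem lowPiece_bounds {b a : ℝ} (hb : 0 < b) (ha : 0 ≤ a) :
    Glo b a - Glo b 0 ≤ ∫ x in (0:ℝ)..a, kint b x ∧
      ∫ x in (0:ℝ)..a, kint b x ≤ Ghi b a - Ghi b 0 := by
  have hkint : IntervalIntegrable (kint b) volume 0 a := (integrable_kint hb).intervalIntegrable
  have hglo : IntervalIntegrable (glo b) volume 0 a := (continuous_glo hb).intervalIntegrable _ _
  have hghi : IntervalIntegrable (ghi b) volume 0 a := (continuous_ghi hb).intervalIntegrable _ _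
  have hF1 : ∫ x in (0:ℝ)..a, glo b x = Glo b a - Glo b 0 :=
    integral_eq_sub_of_hasDerivAt (fun x _ => hasDerivAt_Glo hb x) hglo
  have hF2 : ∫ x in (0:ℝ)..a, ghi b x = Ghi b a - Ghi b 0 :=
    integral_eq_sub_of_hasDerivAt (fun x _ => hasDerivAt_Ghi hb x) hghi
  constructor
  · rw [← hF1]
    exact intervalIntegral.integral_mono_on ha hglo hkint fun x _ => (kint_bounds_low (x := x) hb).1
  · rw [← hF2]
    exact intervalIntegral.integral_mono_on ha hkint hghi fun x _ => (kint_bounds_low (x := x) hb).2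

/-- `−arsinh(1/x) → 0` as `x → ∞`. [folklore] -/
private theorem tendsto_neg_arsinh_inv : Tendsto (fun x : ℝ => -Real.arsinh x⁻¹) atTop (𝓝 0) := by
  have h2 : Tendsto (fun x : ℝ => Real.arsinh x⁻¹) atTop (𝓝 0) := by
    have := (Real.continuous_arsinh.tendsto 0).comp tendsto_inv_atTop_zero
    simpa [Real.arsinh_zero, Function.comp_def] using this
  simpa using h2.neg

/-- `√(x²+1)/x² → 0` as `x → ∞`. [folklore] -/
private theorem tendsto_sqrt_div_sq : Tendsto (fun x : ℝ => Real.sqrt (x ^ 2 + 1) / x ^ 2) atTop (𝓝 0) := by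
  have hup : Tendsto (fun x : ℝ => Real.sqrt 2 * x⁻¹) atTop (𝓝 0) := by
    simpa using tendsto_inv_atTop_zero.const_mul (Real.sqrt 2)
  refine tendsto_of_tendsto_of_tendsto_of_le_of_le' tendsto_const_nhds hup ?_ ?_
  · filter_upwards [eventually_gt_atTop 0] with x hx
    positivity
  · filter_upwards [eventually_ge_atTop 1] with x hx
    have hx0 : 0 < x := by linarith
    have h2 : Real.sqrt (x ^ 2 + 1) ≤ Real.sqrt 2 * x := by
      rw [show Real.sqrt 2 * x = Real.sqrt (2 * x ^ 2) by
        rw [Real.sqrt_mul (by norm_num), Real.sqrt_sq hx0.le]]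
      exact Real.sqrt_le_sqrt (by nlinarith)
    rw [div_le_iff₀ (by positivity)]
    calc Real.sqrt (x ^ 2 + 1) ≤ Real.sqrt 2 * x := h2
      _ = Real.sqrt 2 * x⁻¹ * x ^ 2 := by rw [sq, ← mul_assoc, inv_mul_cancel_right₀ hx0.ne']

/-- `Hlo b x → 0` as `x → ∞`. [folklore] -/
private theorem tendsto_Hlo (b : ℝ) : Tendsto (Hlo b) atTop (𝓝 0) := by
  have h := (tendsto_neg_arsinh_inv.const_mul (1 + b ^ 2 / 4)).add
    (tendsto_sqrt_div_sq.const_mul (b ^ 2 / 4))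
  show Tendsto (fun x : ℝ => (1 + b ^ 2 / 4) * -Real.arsinh x⁻¹ + b ^ 2 / 4 * (Real.sqrt (x ^ 2 + 1) / x ^ 2))
    atTop (𝓝 0)
  simpa using h

/-- `Hhi b x → 0` as `x → ∞`. [folklore] -/
private theorem tendsto_Hhi (b : ℝ) : Tendsto (Hhi b) atTop (𝓝 0) := by
  have h1 := tendsto_Hlo b
  have h2 : Tendsto (fun x : ℝ => (x ^ 2)⁻¹) atTop (𝓝 0) :=
    (tendsto_pow_atTop two_ne_zero).inv_tendsto_atTop
  have h3 : Tendsto (fun x : ℝ => 3 / 8 - 1 / 4 * (x ^ 2)⁻¹) atTop (𝓝 (3 / 8 - 1 / 4 * 0)) :=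
    tendsto_const_nhds.sub (h2.const_mul _)
  have h4 := ((tendsto_sqrt_div_sq.mul h3).add (tendsto_neg_arsinh_inv.const_mul (3 / 8 : ℝ))).const_mul
    (3 * b ^ 4 / 8)
  have h := h1.add h4
  show Tendsto (fun x : ℝ => Hlo b x + 3 * b ^ 4 / 8 * (Real.sqrt (x ^ 2 + 1) / x ^ 2 * (3 / 8 - 1 / 4 * (x ^ 2)⁻¹)
      + 3 / 8 * -Real.arsinh x⁻¹)) atTop (𝓝 0)
  simpa using h

/-- `hlo b ≥ 0` beyond `a` when `b² ≤ 2a²`. [folklore] -/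
private theorem hlo_nonneg {b a x : ℝ} (ha : 0 < a) (hab : b ^ 2 ≤ 2 * a ^ 2) (hx : a < x) : 0 ≤ hlo b x := by
  have hx0 : 0 < x := ha.trans hx
  unfold hlo
  apply mul_nonneg _ (by positivity)
  rw [sub_nonneg, div_le_one (by positivity)]
  nlinarith

/-- `hhi b ≥ 0` beyond `a` when `b² ≤ 2a²`. [folklore] -/
private theorem hhi_nonneg {b a x : ℝ} (ha : 0 < a) (hab : b ^ 2 ≤ 2 * a ^ 2) (hx : a < x) : 0 ≤ hhi b x := by
  have hx0 : 0 < x := ha.trans hx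
  unfold hhi
  apply mul_nonneg _ (by positivity)
  have h1 : b ^ 2 / (2 * x ^ 2) ≤ 1 := by
    rw [div_le_one (by positivity)]
    nlinarith
  have h2 : 0 ≤ 3 * b ^ 4 / (8 * x ^ 4) := by positivity
  linarith

/-- UPPER PIECE: `-Hlo(a) ≤ ∫_{(a,∞)} kint ≤ -Hhi(a)` (`b² ≤ 2a²`). [folklore] -/
private theorem highPiece_bounds {b a : ℝ} (hb : 0 < b) (ha : 0 < a) (hab : b ^ 2 ≤ 2 * a ^ 2) :
    -Hlo b a ≤ ∫ x in Ioi a, kint b x ∧ ∫ x in Ioi a, kint b x ≤ -Hhi b a := by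
  have hkint : IntegrableOn (kint b) (Ioi a) := (integrable_kint hb).integrableOn
  have hc1 : ContinuousWithinAt (Hlo b) (Ici a) a :=
    (hasDerivAt_Hlo b ha).continuousAt.continuousWithinAt
  have hd1 : ∀ x ∈ Ioi a, HasDerivAt (Hlo b) (hlo b x) x := fun x hx => hasDerivAt_Hlo b (ha.trans hx)
  have hp1 : ∀ x ∈ Ioi a, 0 ≤ hlo b x := fun x hx => hlo_nonneg ha hab hx
  have hI1 : ∫ x in Ioi a, hlo b x = 0 - Hlo b a :=
    integral_Ioi_of_hasDerivAt_of_nonneg hc1 hd1 hp1 (tendsto_Hlo b)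
  have hint1 : IntegrableOn (hlo b) (Ioi a) :=
    integrableOn_Ioi_deriv_of_nonneg hc1 hd1 hp1 (tendsto_Hlo b)
  have hc2 : ContinuousWithinAt (Hhi b) (Ici a) a :=
    (hasDerivAt_Hhi b ha).continuousAt.continuousWithinAt
  have hd2 : ∀ x ∈ Ioi a, HasDerivAt (Hhi b) (hhi b x) x := fun x hx => hasDerivAt_Hhi b (ha.trans hx)
  have hp2 : ∀ x ∈ Ioi a, 0 ≤ hhi b x := fun x hx => hhi_nonneg ha hab hx
  have hI2 : ∫ x in Ioi a, hhi b x = 0 - Hhi b a :=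
    integral_Ioi_of_hasDerivAt_of_nonneg hc2 hd2 hp2 (tendsto_Hhi b)
  have hint2 : IntegrableOn (hhi b) (Ioi a) :=
    integrableOn_Ioi_deriv_of_nonneg hc2 hd2 hp2 (tendsto_Hhi b)
  constructor
  · have h := setIntegral_mono_on hint1 hkint measurableSet_Ioi
      (fun x hx => (kint_bounds_high (x := x) hb (ha.trans hx)).1)
    rw [hI1] at h
    linarith
  · have h := setIntegral_mono_on hkint hint2 measurableSet_Ioi
      (fun x hx => (kint_bounds_high (x := x) hb (ha.trans hx)).2)
    rw [hI2] at h
    linarith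


/-! ### D. Assembly: the sharp two-sided logarithmic bound -/

/-- `Glo b 0 = 0`. [folklore] -/
private theorem Glo_zero (b : ℝ) : Glo b 0 = 0 := by simp [Glo]

/-- `Ghi b 0 = 0`. [folklore] -/
private theorem Ghi_zero (b : ℝ) : Ghi b 0 = 0 := by simp [Ghi, Glo]

set_option maxHeartbeats 400000 in
/-- `log(4/b) ≤ K(1-b²) ≤ (1 + b²/4) log(4/b)` for `0 < b`, `b² ≤ 1/2`. [cite: BorweinBorwein1987, §1.3 (1.3.10)] -/
theorem ellipticK_log_two_sided {b : ℝ} (hb : 0 < b) (hb2 : b ^ 2 ≤ 1 / 2) :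
    2 * Real.log 2 - Real.log b ≤ ellipticK (1 - b ^ 2) ∧
      ellipticK (1 - b ^ 2) ≤ (1 + b ^ 2 / 4) * (2 * Real.log 2 - Real.log b) := by
  have hbne : b ≠ 0 := hb.ne'
  have hb1 : b ≤ 1 := by nlinarith
  have hb7 : b ≤ 0.7072 := by nlinarith
  -- the pieces at `a = √b`
  have hr0 : 0 < Real.sqrt b := Real.sqrt_pos.2 hb
  have hr2 : Real.sqrt b ^ 2 = b := Real.sq_sqrt hb.le
  have hK := ellipticK_eq_integral_kint hb
  have hsplit := integral_kint_split hb hr0.le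
  obtain ⟨hL1, hL2⟩ := lowPiece_bounds hb hr0.le
  obtain ⟨hU1, hU2⟩ := highPiece_bounds hb hr0 (by nlinarith)
  have hE1 := log_one_add_sqrt_lb hb.le hb1
  have hE3 := log_one_add_sqrt_ub hb.le hb1
  rw [Glo_zero, sub_zero] at hL1
  rw [Ghi_zero, sub_zero] at hL2
  set r := Real.sqrt b with hr
  set s := Real.sqrt (1 + b) with hs
  have hs1 : 1 ≤ s := Real.one_le_sqrt.mpr (by linarith)
  have hs2 : s ^ 2 = 1 + b := Real.sq_sqrt (by linarith)
  have hshi : s ≤ 1 + b / 2 := by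
    have h := Real.sqrt_le_sqrt (show 1 + b ≤ (1 + b / 2) ^ 2 by nlinarith)
    rwa [Real.sqrt_sq (by linarith)] at h
  have hslo : 1 + b / 2 - b ^ 2 / 8 ≤ s := by
    have h := Real.sqrt_le_sqrt (show (1 + b / 2 - b ^ 2 / 8) ^ 2 ≤ 1 + b by nlinarith)
    rwa [Real.sqrt_sq (by nlinarith)] at h
  have hr4 : r ^ 4 = b ^ 2 := by rw [← hr2]; ring
  -- point facts at `a = r`
  have f1 : r / b = r⁻¹ := by
    rw [div_eq_iff hbne, inv_mul_eq_div, eq_div_iff hr0.ne', ← sq, hr2]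
  have f2 : Real.sqrt (r ^ 2 + b ^ 2) = r * s := by
    rw [hr2, show b + b ^ 2 = b * (1 + b) by ring, Real.sqrt_mul hb.le]
  have f3 : Real.sqrt (r ^ 2 + 1) = s := by rw [hr2, add_comm]
  -- the arsinh as a logarithm
  set ℓ := Real.arsinh r⁻¹ with hl
  have hℓ : ℓ = Real.log (1 + s) - Real.log b / 2 := by
    rw [hl, Real.arsinh]
    have e1 : Real.sqrt (1 + r⁻¹ ^ 2) = s / r := by
      rw [inv_pow, hr2, show 1 + b⁻¹ = (1 + b) / b by field_simp; ring, Real.sqrt_div (by linarith) b]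
    rw [e1, show r⁻¹ + s / r = (1 + s) / r by rw [inv_eq_one_div, ← add_div],
      Real.log_div (by positivity) hr0.ne', hr, Real.log_sqrt hb.le]
  -- values of the antiderivatives at `r`
  have vGlo : Glo b r = (1 + b ^ 2 / 4) * ℓ - b * s / 4 := by
    simp only [Glo]
    rw [f1, f2]
    have e : r * (r * s) = b * s := by rw [← mul_assoc, ← sq, hr2]
    rw [e]
  have vGhi : Ghi b r = (1 + b ^ 2 / 4) * ℓ - b * s / 4
      + 3 / 8 * ((b ^ 2 / 4 - 3 * b ^ 3 / 8) * s + 3 * b ^ 4 / 8 * ℓ) := by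
    have e : (r ^ 3 / 4 - 3 * b ^ 2 * r / 8) * (r * s) = (b ^ 2 / 4 - 3 * b ^ 3 / 8) * s := by
      have : (r ^ 3 / 4 - 3 * b ^ 2 * r / 8) * (r * s) = (r ^ 4 / 4 - 3 * b ^ 2 * r ^ 2 / 8) * s := by ring
      rw [this, hr4, hr2]
      ring
    simp only [Ghi]
    rw [vGlo, f1, f2, e]
  have vHlo : Hlo b r = -((1 + b ^ 2 / 4) * ℓ) + b * s / 4 := by
    simp only [Hlo]
    rw [f3, hr2, ← hl]
    field_simp
  have vHhi : Hhi b r = -((1 + b ^ 2 / 4) * ℓ) + b * s / 4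
      + 3 * b ^ 4 / 8 * (s / b * (3 / 8 - 1 / 4 * b⁻¹) + 3 / 8 * -ℓ) := by
    simp only [Hhi]
    rw [vHlo, f3, hr2]
  have vHhi' : Hhi b r = -((1 + b ^ 2 / 4) * ℓ) + b * s / 4
      + (9 * b ^ 3 / 64 * s - 3 * b ^ 2 / 32 * s - 9 * b ^ 4 / 64 * ℓ) := by
    rw [vHhi]
    congr 1
    field_simp
    ring
  -- the two-sided bound on `K`
  have hKsum : ellipticK (1 - b ^ 2) = (∫ x in (0:ℝ)..r, kint b x) + ∫ x in Ioi r, kint b x := by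
    rw [hK, hsplit]
  rw [vGlo] at hL1
  rw [vGhi] at hL2
  rw [vHlo] at hU1
  rw [vHhi'] at hU2
  rw [hℓ] at hL1 hL2 hU1 hU2
  -- logarithm facts
  have hL2lo : (0.6931471803 : ℝ) < Real.log 2 := Real.log_two_gt_d9
  have hL2hi : Real.log 2 < (0.6931471808 : ℝ) := Real.log_two_lt_d9
  have hlbhi : Real.log b ≤ b - 1 := Real.log_le_sub_one_of_pos hb
  have hlblo : 1 - b⁻¹ ≤ Real.log b := Real.one_sub_inv_le_log_of_pos hb
  constructor
  · -- lower bound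
    have h1 : (2 + b ^ 2 / 2) * (Real.log 2 + b / 4 - 3 * b ^ 2 / 32)
        ≤ (2 + b ^ 2 / 2) * Real.log (1 + s) := mul_le_mul_of_nonneg_left hE1 (by positivity)
    have h2 : b * s ≤ b * (1 + b / 2) := mul_le_mul_of_nonneg_left hshi hb.le
    have h3 : b ^ 2 / 4 * Real.log b ≤ b ^ 2 / 4 * (b - 1) := mul_le_mul_of_nonneg_left hlbhi (by positivity)
    have h4 : 0 ≤ Real.log 2 / 2 - 3 / 16 - b / 8 - 3 * b ^ 2 / 64 := by linarith
    have h5 : 0 ≤ b ^ 2 * (Real.log 2 / 2 - 3 / 16 - b / 8 - 3 * b ^ 2 / 64) := mul_nonneg (sq_nonneg b) h4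
    rw [hKsum]
    linarith [h1, h2, h3, h5, hL1, hU1]
  · -- upper bound
    have h1 : (2 + b ^ 2 / 2) * (Real.log (1 + s) - Real.log 2)
        ≤ (2 + b ^ 2 / 2) * (b / 4 - 3 * b ^ 2 / 32 + 5 * b ^ 3 / 96) :=
      mul_le_mul_of_nonneg_left (by linarith) (by positivity)
    have h2 : b * (1 + b / 2 - b ^ 2 / 8) ≤ b * s := mul_le_mul_of_nonneg_left hslo hb.le
    have h3 : 3 * b ^ 2 / 16 * s ≤ 3 * b ^ 2 / 16 * (1 + b / 2) :=
      mul_le_mul_of_nonneg_left hshi (by positivity)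
    have h4 : 9 * b ^ 3 / 32 * 1 ≤ 9 * b ^ 3 / 32 * s := mul_le_mul_of_nonneg_left hs1 (by positivity)
    have h5 : 9 * b ^ 4 / 32 * Real.log (1 + s)
        ≤ 9 * b ^ 4 / 32 * (Real.log 2 + b / 4 - 3 * b ^ 2 / 32 + 5 * b ^ 3 / 96) :=
      mul_le_mul_of_nonneg_left hE3 (by positivity)
    have h6 : -(9 * b ^ 4 / 64) * Real.log b ≤ 9 * b ^ 3 / 64 - 9 * b ^ 4 / 64 := by
      have hneg : -Real.log b ≤ b⁻¹ - 1 := by linarith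
      have h := mul_le_mul_of_nonneg_left hneg (by positivity : (0:ℝ) ≤ 9 * b ^ 4 / 64)
      have e : 9 * b ^ 4 / 64 * (b⁻¹ - 1) = 9 * b ^ 3 / 64 - 9 * b ^ 4 / 64 := by
        field_simp
      linarith
    have hbb : 0 ≤ b ^ 2 := sq_nonneg b
    have hb4 : 0 ≤ b ^ 4 := by positivity
    have hb6 : 0 ≤ b ^ 6 := by positivity
    have hb3 : b ^ 3 ≤ 0.354 := by
      have h := mul_le_mul_of_nonneg_left hb2 hb.le
      calc b ^ 3 = b * b ^ 2 := by ring
        _ ≤ b * (1 / 2) := h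
        _ ≤ 0.354 := by linarith
    have p1 : b ^ 3 ≤ 0.7072 * b ^ 2 := by
      have h := mul_le_mul_of_nonneg_right hb7 hbb
      calc b ^ 3 = b * b ^ 2 := by ring
        _ ≤ 0.7072 * b ^ 2 := h
    have p2 : b ^ 4 ≤ b ^ 2 / 2 := by
      have h := mul_le_mul_of_nonneg_right hb2 hbb
      calc b ^ 4 = b ^ 2 * b ^ 2 := by ring
        _ ≤ 1 / 2 * b ^ 2 := h
        _ = b ^ 2 / 2 := by ring
    have p3 : b ^ 5 ≤ 0.354 * b ^ 2 := by
      have h := mul_le_mul_of_nonneg_right hb3 hbb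
      calc b ^ 5 = b ^ 3 * b ^ 2 := by ring
        _ ≤ 0.354 * b ^ 2 := h
    have hb5 : b ^ 5 ≤ 0.18 := by
      have h : 0.354 * b ^ 2 ≤ 0.354 * (1 / 2) := by linarith
      linarith
    have p4 : b ^ 7 ≤ 0.18 * b ^ 2 := by
      have h := mul_le_mul_of_nonneg_right hb5 hbb
      calc b ^ 7 = b ^ 5 * b ^ 2 := by ring
        _ ≤ 0.18 * b ^ 2 := h
    have p5 : Real.log 2 * b ^ 4 ≤ 0.6931471808 * b ^ 4 := mul_le_mul_of_nonneg_right hL2hi.le hb4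
    -- the polynomial tail is negative
    have hq : (2 + b ^ 2 / 2) * (b / 4 - 3 * b ^ 2 / 32 + 5 * b ^ 3 / 96) - b * (1 + b / 2 - b ^ 2 / 8) / 2
        + 3 * b ^ 2 / 16 * (1 + b / 2) - 9 * b ^ 3 / 32 * 1
        + 9 * b ^ 4 / 32 * (Real.log 2 + b / 4 - 3 * b ^ 2 / 32 + 5 * b ^ 3 / 96)
        + (9 * b ^ 3 / 64 - 9 * b ^ 4 / 64) ≤ 0 := by
      linarith [p1, p2, p3, p4, p5, hb6, hb4]
    rw [hKsum]
    linarith [h1, h2, h3, h4, h5, h6, hq, hL2, hU2]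

/-- **K2.**  The sharp logarithmic remainder of `K` near `m = 1` (= `EllipticKLogRemainder` of
Sketch13.lean): `0 ≤ K(m) - ½ log(16/(1-m)) ≤ ((1-m)/4) · ½ log(16/(1-m))` for `1/2 ≤ m < 1`. [cite: BorweinBorwein1987, §1.3 (1.3.10)] -/
theorem ellipticK_log_remainder (m : ℝ) (hm : 1 / 2 ≤ m) (hm1 : m < 1) :
    0 ≤ ellipticK m - Real.log (16 / (1 - m)) / 2 ∧
      ellipticK m - Real.log (16 / (1 - m)) / 2 ≤ (1 - m) / 4 * (Real.log (16 / (1 - m)) / 2) := by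
  set b := Real.sqrt (1 - m) with hb
  have h1m : 0 < 1 - m := by linarith
  have hb0 : 0 < b := Real.sqrt_pos.2 h1m
  have hb2 : b ^ 2 = 1 - m := Real.sq_sqrt h1m.le
  have hbsq : b ^ 2 ≤ 1 / 2 := by rw [hb2]; linarith
  obtain ⟨hlo, hhi⟩ := ellipticK_log_two_sided hb0 hbsq
  have hm' : 1 - b ^ 2 = m := by rw [hb2]; ring
  rw [hm'] at hlo hhi
  have hlog : Real.log (16 / (1 - m)) / 2 = 2 * Real.log 2 - Real.log b := by
    rw [← hb2, Real.log_div (by norm_num) (by positivity), Real.log_pow,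
      show (16:ℝ) = 2 ^ 4 by norm_num, Real.log_pow]
    push_cast
    ring
  rw [hlog, ← hb2]
  constructor
  · linarith
  · nlinarith [hhi]

end EllipticKLogSharp

/-! ### Exported statements (namespace `Literature.Analysis.SpecialFunctions`) -/

/-- `log 4 = 2 log 2`. [folklore] -/
private theorem log_four_eq : Real.log 4 = 2 * Real.log 2 := by
  rw [show (4 : ℝ) = 2 ^ 2 by norm_num, Real.log_pow]; push_cast; ring

/-- **Sharp logarithmic lower bound** `log(4/k′) ≤ K(u)`, `k′ = √(1-u)`, for `1/2 ≤ u < 1`.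
(The classical expansion `K = log(4/k′) + ¼(log(4/k′) - 1)k′² + …` has nonnegative corrections;
[cite: BorweinBorwein1987, §1.3 (1.3.10)] for the leading term. Proved here from the AGM integral,
no series.) -/
theorem log_four_div_le_ellipticK {u : ℝ} (hu : 1 / 2 ≤ u) (hu1 : u < 1) :
    Real.log (4 / Real.sqrt (1 - u)) ≤ ellipticK u := by
  have h1u : 0 < 1 - u := by linarith
  have hb : 0 < Real.sqrt (1 - u) := Real.sqrt_pos.2 h1u
  have hsq : Real.sqrt (1 - u) ^ 2 = 1 - u := Real.sq_sqrt h1u.le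
  have hb2 : Real.sqrt (1 - u) ^ 2 ≤ 1 / 2 := by rw [hsq]; linarith
  have h := (EllipticKLogSharp.ellipticK_log_two_sided hb hb2).1
  rw [hsq, show 1 - (1 - u) = u by ring] at h
  rw [Real.log_div (by norm_num) hb.ne', log_four_eq]
  exact h

/-- **Sharp logarithmic upper bound** `K(u) ≤ (1 + k′²/4)·log(4/k′)`, `k′ = √(1-u)`, for
`1/2 ≤ u < 1` — the constant `log 4` is optimal (`K(u) - log(4/k′) → 0` as `u → 1`); compare the
cruder `ellipticK_le_log` (`+ 2 log(1+√2) - log 4`). [cite: BorweinBorwein1987, §1.3 (1.3.10)] for the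
asymptotics; the explicit two-sided inequality is proved here. -/
theorem ellipticK_le_log_four_div {u : ℝ} (hu : 1 / 2 ≤ u) (hu1 : u < 1) :
    ellipticK u ≤ (1 + (1 - u) / 4) * Real.log (4 / Real.sqrt (1 - u)) := by
  have h1u : 0 < 1 - u := by linarith
  have hb : 0 < Real.sqrt (1 - u) := Real.sqrt_pos.2 h1u
  have hsq : Real.sqrt (1 - u) ^ 2 = 1 - u := Real.sq_sqrt h1u.le
  have hb2 : Real.sqrt (1 - u) ^ 2 ≤ 1 / 2 := by rw [hsq]; linarith
  have h := (EllipticKLogSharp.ellipticK_log_two_sided hb hb2).2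
  rw [hsq, show 1 - (1 - u) = u by ring] at h
  rw [Real.log_div (by norm_num) hb.ne', log_four_eq]
  exact h

/-- The two-sided bound in complementary-modulus form: for `0 < b`, `b² ≤ 1/2`,
`2 log 2 - log b ≤ K(1 - b²) ≤ (1 + b²/4)(2 log 2 - log b)`. [cite: BorweinBorwein1987, §1.3 (1.3.10)] -/
theorem ellipticK_compl_log_two_sided {b : ℝ} (hb : 0 < b) (hb2 : b ^ 2 ≤ 1 / 2) :
    2 * Real.log 2 - Real.log b ≤ ellipticK (1 - b ^ 2) ∧
      ellipticK (1 - b ^ 2) ≤ (1 + b ^ 2 / 4) * (2 * Real.log 2 - Real.log b) :=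
  EllipticKLogSharp.ellipticK_log_two_sided hb hb2

/-- Remainder form: for `1/2 ≤ m < 1`, with `L = ½ log(16/(1-m)) = log(4/k′)`,
`0 ≤ K(m) - L ≤ ¼(1-m)·L`. [cite: BorweinBorwein1987, §1.3 (1.3.10)] -/
theorem ellipticK_sub_log_mem {m : ℝ} (hm : 1 / 2 ≤ m) (hm1 : m < 1) :
    0 ≤ ellipticK m - Real.log (16 / (1 - m)) / 2 ∧
      ellipticK m - Real.log (16 / (1 - m)) / 2 ≤ (1 - m) / 4 * (Real.log (16 / (1 - m)) / 2) :=
  EllipticKLogSharp.ellipticK_log_remainder m hm hm1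

end Literature.Analysis.SpecialFunctions

end
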